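import Summits.BirchSwinnertonDyer.BirchSwinnertonDyer.Theorems.KatoDescentPotSupersingularWildLowerDesc3Shape
import Summits.BirchSwinnertonDyer.BirchSwinnertonDyer.Theorems.KatoDescentPotSupersingularWildLowerSubgroupWitness
import HarnessLib

/-!
# Route `KatoDescentPotSupersingular` (rung K9, cell `bsd-potss`), child crux `WildLowerIntrinsicNonCM`
# (item stmt-BirchSwinnertonDyer-19663), registered stubs `stub_intr_red` / `stub_intr_irred_residual`: the
# DEEP (second-descent / Cassels–Tate-zero) per-class road in record SHAPE — «literal member `W₀` with
# `ord₃ #Ш_an(W₀) ≤ 4` + an element of `Ш(W₀)` of order `9` and an independent `3`-torsion element ⇒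
# `MissingLowerBoundAt W 3` at every globally minimal member» (seat `bsd-potss-k9-desc3`, ACCEL row (2) of
# planner bsd-potss-plan g14; a `--supports stmt-BirchSwinnertonDyer-19663 --as helper` file; closes NOTHING
# class-wide)

PARTITION (D-0054, cell bsd-potss): EXCLUDED-DOMAIN non-CM additive `p` · B5 O6 wild `3`, `r_an = 0`,
INTRINSIC classes whose certificate member has `ord₃ #Ш_an = 4`: the 29 X3 MIRROR classes `{E, E^}`
(`#Ш_an(E) = 9` with `Ш(E)[φ] = 0`, `#Ш_an(E^) = 81` with `dim Ш(E^)[φ̂] = 2`; k9-c2 kit j250560) — rows of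
`Sig.stub_intr_red` — and the 11 DEEP X4 classes (`#Ш_an = 81` at the minimal member; rows of
`Sig.stub_intr_kimRows` / `…_irred_residual` / `…_irred_fwLocus`). On these a FIRST descent certifies only
`ord₃ #Ш ≥ 2`; the lower half needs `ord₃ #Ш ≥ 4`, i.e. `Ш[3] ⊆ 3·Ш` — the vanishing of the Cassels–Tate
pairing on `Ш[3]` (k9-c2 v2: van Beek–Fisher `ctpc.gp` j250725/j250763, `ctgen.gp` j250793, `ctmu.gp`
j250842 on the 29 mirror classes: verdict rank `0` of `2` on all; NOT run on the 11 deep X4 classes, where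
`E[3]` is irreducible: Creutz's second `3`-descent / Fisher–Newton, cf. b2b rule V17 on `19215t1`).
Class-wide the stubs are Kato's Conj. 12.10 lower half at the wild prime `3` — OPEN; nothing here proves them.

WHAT THIS FILE DOES (theorems only; no definition, no named fact, no `sorry`): the literal-model forms of
k9-c2 g3's class-free deep slot `missingLowerBoundAt_of_deepWitness_of_le_four` (p421575's sequel
`…WildLowerSubgroupWitness.lean`: `x` of order `p²` and a `p`-torsion `y ∉ ℤx` give `p³ ∣ #Ш`, hence
`4 ≤ ord_p #Ш` by the Cassels–Tate rounding) — at `W₀` (§1) and at every globally minimal `W ∼_ℚ W₀`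
(§2, Cassels transport `TwistComparison.missingLowerBoundAt_of_isIsogenous`), with `Δ ≠ 0` and global
minimality of the literal model as the record's kernel-decided terms.

HONEST LABEL: per class a finite certificate road over four PUBLISHED facts by name (Cassels–Tate, Cassels,
GZK, modularity); the deep witness `(x, y)` is a binder whose evidence (a second descent or a Cassels–Tate
computation on `Ш[3]`) lives outside the kernel; BSD is not proved; the item is NOT closed; nothing booked.

References: [SilvermanAEC2009] Thm. X.4.14; [Cassels1965ArithmeticVIII]; [MilneADT2006] Thm. I.7.3;
[Miller2011LMS] Def. 1.1; B. Creutz, Math. Comp. 83 (2014) 365–409; M. van Beek, T. Fisher, "Computing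
the Cassels–Tate pairing on 3-isogeny Selmer groups via cubic norm equations", Acta Arith. 185 (2018);
[Kato2004Asterisque] Conj. 12.10 (p. 224).
-/

set_option autoImplicit false
-- sibling precedent (`KatoDescentPotSupersingularAssembly.lean`): the directory name repeats the summit name
set_option linter.dupNamespace false

noncomputable section

open scoped Classical

namespace Summit.BirchSwinnertonDyer.BirchSwinnertonDyer.Theorems

open WeierstrassCurve Literature.NumberTheory.EllipticCurves
  Literature.NumberTheory.EllipticCurves.Rank1Residual
  Literature.NumberTheory.EllipticCurves.Rank1Residual.Typed
  Literature.NumberTheory.EllipticCurves.Rank1Residual.X11RankOneCertificates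
  Summit.BirchSwinnertonDyer.BirchSwinnertonDyer.Rank1Residual.IntModel
  Summit.BirchSwinnertonDyer.Rank1Residual
  Summit.BirchSwinnertonDyer.Rank1Residual.Additive
  Summit.BirchSwinnertonDyer.Rank1Residual.Supersingular
  Summit.BirchSwinnertonDyer.BirchSwinnertonDyer.Theses.KatoDescentPotSupersingular

/-! ## §1 Class-free transport form of the deep slot -/

/-- **`MissingLowerBoundAt W 3` at EVERY globally minimal member `W` of the class of a member `W₀` carrying
a DEEP witness** (class-free): `W₀` globally minimal of analytic rank `0` with `#Ш_an(W₀) = s`,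
`ord₃ s ≤ 4`, an element `x ∈ Ш(W₀)` of order `9` and a `3`-torsion element `y ∉ ℤx` ⇒ the lower half at
every globally minimal `W ∼_ℚ W₀` (k9-c2's `missingLowerBoundAt_of_deepWitness_of_le_four` at `W₀`:
`27 ∣ #Ш`, rounded to `81 ∣ #Ш` by Cassels–Tate; then `TwistComparison.missingLowerBoundAt_of_isIsogenous`).
The `ClassO6`-free twin of k9-c2's `missingLowerBoundAt_wild_of_isIsogenous_deepWitness`. Conditional on
the four published facts and the witness slot. [cite: MilneADT2006, Thm. I.7.3]
[cite: SilvermanAEC2009, Thm. X.4.14] [cite: Miller2011LMS, §1 and Def. 1.1] -/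
theorem K9Desc3.missingLowerBoundAt_three_of_isIsogenous_of_deepWitness
    (hCT : exists_casselsTate_pairing (K := ℚ)) (hCassels : bsdRHS_eq_of_isIsogenous)
    (hGZK : rank_eq_analyticRank_of_analyticRank_le_one) (hmod : hasEntireLFunction_rat)
    (W₀ : WeierstrassCurve ℚ) [W₀.IsElliptic] [W₀.IsGloballyMinimal] (hr : W₀.analyticRank = 0)
    {s : ℚ} (hs : shaAn W₀ = (s : ℂ)) (hv : padicValRat 3 s ≤ 4) {x y : W₀.sha}
    (hx : addOrderOf x = 3 ^ 2) (h3y : 3 • y = 0) (hy : y ∉ AddSubgroup.zmultiples x)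
    (W : WeierstrassCurve ℚ) [W.IsElliptic] [W.IsGloballyMinimal] (hiso : IsIsogenous W W₀) :
    MissingLowerBoundAt W 3 := by
  haveI : Fact (Nat.Prime 3) := ⟨Nat.prime_three⟩
  have hr' : W₀.analyticRank ≤ 1 := by rw [hr]; exact zero_le_one
  exact TwistComparison.missingLowerBoundAt_of_isIsogenous W₀ W 3 hCassels hGZK hmod
    hiso.symm_of_charZero hr'
    (missingLowerBoundAt_of_deepWitness_of_le_four W₀ 3 hCT hGZK hr' hs hv hx h3y hy)

/-! ## §2 RECORD SHAPES at a literal member -/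

/-- **RECORD SHAPE (deep) at a literal model.** `W₀ = ⟨a₁,…,a₆⟩` with `Δ ≠ 0` (`h0`, kernel-decided); per
pair: `r_an = 0` (`hr`), `#Ш_an = s`, `ord₃ s ≤ 4` (`hs`, `hv`), and the deep witness in `Ш(W₀)`: `x` of order
`9`, `y` with `3•y = 0`, `y ∉ ℤx` (`hx`, `h3y`, `hy`; evidence = a Cassels–Tate-on-`Ш[3]` or second-descent
computation) ⇒ `MissingLowerBoundAt W₀ 3` (k9-c2's class-free `missingLowerBoundAt_of_deepWitness_of_le_four`
on the literal model). Per pair; nothing booked. [cite: SilvermanAEC2009, Thm. X.4.14]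
[cite: Miller2011LMS, §1 and Def. 1.1] -/
theorem K9Desc3.missingLowerBoundAt_three_of_ainvs_of_deepWitness
    (hCT : exists_casselsTate_pairing (K := ℚ)) (hGZK : rank_eq_analyticRank_of_analyticRank_le_one)
    (a1 a2 a3 a4 a6 : ℤ) (h0 : discOf [a1, a2, a3, a4, a6] ≠ 0)
    (hr : (⟨a1, a2, a3, a4, a6⟩ : WeierstrassCurve ℚ).analyticRank = 0)
    {s : ℚ} (hs : shaAn (⟨a1, a2, a3, a4, a6⟩ : WeierstrassCurve ℚ) = (s : ℂ))
    (hv : padicValRat 3 s ≤ 4) {x y : (⟨a1, a2, a3, a4, a6⟩ : WeierstrassCurve ℚ).sha}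
    (hx : addOrderOf x = 3 ^ 2) (h3y : 3 • y = 0) (hy : y ∉ AddSubgroup.zmultiples x) :
    MissingLowerBoundAt (⟨a1, a2, a3, a4, a6⟩ : WeierstrassCurve ℚ) 3 := by
  haveI := X11b.isElliptic_of_discOf_ne_zero a1 a2 a3 a4 a6 h0
  haveI : Fact (Nat.Prime 3) := ⟨Nat.prime_three⟩
  exact missingLowerBoundAt_of_deepWitness_of_le_four _ 3 hCT hGZK (by rw [hr]; exact zero_le_one) hs hv
    hx h3y hy

/-- **RECORD SHAPE (deep) along the class — literal certificate member.** As the previous theorem plus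
global minimality of the literal model (`hmin`, the record's Kraus term), Cassels `hCassels` and modularity
`hmod`: `MissingLowerBoundAt W 3` at every globally minimal `W ∼_ℚ W₀ = ⟨a₁,…,a₆⟩` (binder `hiso` = the
Cremona class datum). Per class; nothing booked. [cite: MilneADT2006, Thm. I.7.3]
[cite: SilvermanAEC2009, Thm. X.4.14] [cite: Miller2011LMS, §1 and Def. 1.1] -/
theorem K9Desc3.missingLowerBoundAt_three_of_isIsogenous_ainvs_of_deepWitness
    (hCT : exists_casselsTate_pairing (K := ℚ)) (hCassels : bsdRHS_eq_of_isIsogenous)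
    (hGZK : rank_eq_analyticRank_of_analyticRank_le_one) (hmod : hasEntireLFunction_rat)
    (a1 a2 a3 a4 a6 : ℤ) (h0 : discOf [a1, a2, a3, a4, a6] ≠ 0)
    (hmin : (⟨a1, a2, a3, a4, a6⟩ : WeierstrassCurve ℚ).IsGloballyMinimal)
    (hr : (⟨a1, a2, a3, a4, a6⟩ : WeierstrassCurve ℚ).analyticRank = 0)
    {s : ℚ} (hs : shaAn (⟨a1, a2, a3, a4, a6⟩ : WeierstrassCurve ℚ) = (s : ℂ))
    (hv : padicValRat 3 s ≤ 4) {x y : (⟨a1, a2, a3, a4, a6⟩ : WeierstrassCurve ℚ).sha}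
    (hx : addOrderOf x = 3 ^ 2) (h3y : 3 • y = 0) (hy : y ∉ AddSubgroup.zmultiples x)
    (W : WeierstrassCurve ℚ) [W.IsElliptic] [W.IsGloballyMinimal]
    (hiso : IsIsogenous W (⟨a1, a2, a3, a4, a6⟩ : WeierstrassCurve ℚ)) :
    MissingLowerBoundAt W 3 := by
  haveI := X11b.isElliptic_of_discOf_ne_zero a1 a2 a3 a4 a6 h0
  haveI := hmin
  exact K9Desc3.missingLowerBoundAt_three_of_isIsogenous_of_deepWitness hCT hCassels hGZK hmod _ hr hs hv hx
    h3y hy W hiso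

end Summit.BirchSwinnertonDyer.BirchSwinnertonDyer.Theorems

end
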